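import Summits.BirchSwinnertonDyer.BirchSwinnertonDyer.Theorems.KimAtThreeD7uTamagawaIndex
import Summits.BirchSwinnertonDyer.BirchSwinnertonDyer.Theorems.KimAtThreeD7uTamagawaFreeStructures
import Literature.NumberTheory.EllipticCurves.BSDQuadraticDescentTorsionOddPartProofs
import HarnessLib

/-!
# The TAMAGAWA-DIVISIBLE bad places, VIII: corollaries of the positive-exponent index —
# `p ∣ c_w ⇒ 𝓕_u(w) ⊊ 𝓕_can(w)` at EVERY level, `𝓕_u(w) = 𝓕_can(w) ⇔ p ∤ c_w`, and `[𝓕_can(w) : 𝓕_u(w)] = (c_w)_p`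
# at deep levels (cell `bsd-addord`, seat w2-tamdiv gen 4; route W2 `KimAtThreeKolyvagin`, items 19562 / 19560)

HONEST FRAMING: TOOL theorems (no definition, no named fact, no `sorry`); closes nothing by itself;
nothing is booked; BSD is not proved by any of this.  Consequences of `KimAtThreeD7uTamagawaIndex`
(`#𝓕_can(w)_k = #𝓕_u(w)_k · #Φ_w[p^{k+1}]`, `Φ_w = X(ℚ_w)/X₀(ℚ_w)`, `#Φ_w = c_w`) for an elliptic curve over
`ℚ`, a prime `p`, a finite place `w ∤ p` of ANY reduction type and every level `k`:

* `finite_propagatedSelmerStructure_inr`, `natCard_componentQuotient_eq_localTamagawaNumber` (bookkeeping: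
  `𝓕_can(w)_k` is finite; `#Φ_w = c_w`).
* **`blochKatoSelmerStructure_lt_propagatedSelmerStructure_of_dvd_localTamagawaNumber`**: `p ∣ c_w ⇒
  𝓕_u(w)_k < 𝓕_can(w)_k` — the local sentence of [MR04] Prop. 6.2.6 («`H¹_{𝓕_u}(ℚ_ℓ, E[p]) ⊊ H¹_{𝓕_can}(ℚ_ℓ, E[p])`
  when `p ∣ c_ℓ`») for EVERY reduction type (not only split multiplicative), every `p` (also `p = 2, 3`),
  every level: Cauchy gives `Φ_w[p] ≠ 0`.  This is the strictness that makes [MR04]'s `𝓕_u`-structure drop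
  the core rank (Büyükboduk, JNT 129 (2009) Cor. 2.8 / Thm. 3.1: the exponent-`1` Tamagawa defect of every
  Euler system for `T_pE`).
* **`blochKatoSelmerStructure_eq_propagatedSelmerStructure_iff_not_dvd`**: `𝓕_u(w)_k = 𝓕_can(w)_k ↔ p ∤ c_w`
  (with gen 3's exponent-zero theorem) — the Tamagawa-divisible places are EXACTLY the places of defect.
* **`natCard_propagatedSelmerStructure_inr_eq_mul_pow_padicValNat`**: if `p^{v_p(c_w)} ∣ p^{k+1}` then
  `#𝓕_can(w)_k = #𝓕_u(w)_k · p^{v_p(c_w)}` — Büyükboduk 2009 §2.1.2 Remark 2 / Rubin Lemma 1.3.5's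
  `[H¹_f : H¹_ur] = (c_w)_p` at every sufficiently deep finite level.

References: B. Mazur, K. Rubin, Mem. AMS 799 (2004) Prop. 6.2.6, Remark A.5; K. Büyükboduk, JNT 129 (2009)
§2.1.2 Remark 2, Cor. 2.8, Thm. 3.1; K. Rubin, *Euler Systems* (2000) Lemma 1.3.5.
-/

noncomputable section

-- the cell's Theorems namespace `Summit.BirchSwinnertonDyer.BirchSwinnertonDyer.…` repeats the summit name by design (D-0017)
set_option linter.dupNamespace false

open CategoryTheory Function Field IsDedekindDomain NumberField
open scoped NumberField Classical
open Literature.NumberTheory.GaloisRepresentations Literature.NumberTheory.EllipticCurves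
open Literature.NumberTheory.GaloisRepresentations.IsNonarchimedeanLocalField
open WeierstrassCurve
open Summit.BirchSwinnertonDyer.Rank1Residual.GaloisImage
open Summit.BirchSwinnertonDyer.Rank1Residual.X11b.AcSelmer
open Summit.BirchSwinnertonDyer.BirchSwinnertonDyer.Theorems.KimAtThreeD7uBlochKatoCondition
open Summit.BirchSwinnertonDyer.BirchSwinnertonDyer.Theorems.KimAtThreeD7uTamagawaFreeStructures

namespace Summit.BirchSwinnertonDyer.BirchSwinnertonDyer.Theorems.KimAtThreeD7uTamagawaIndex

variable (W : WeierstrassCurve ℚ) [W.IsElliptic] (p : ℕ) [hp : Fact p.Prime] (k : ℕ)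
  (w : HeightOneSpectrum (𝓞 ℚ))

/-! ### §1 Bookkeeping: finiteness of `𝓕_can(w)_k`, `#Φ_w = c_w` -/

/-- `𝓕_can(w)_k` is finite at a finite place `w ∤ p` (it is the local Kummer condition, Milne I Lemma 3.3).
[cite: MilneADT2006, I Lemma 3.3] -/
theorem finite_propagatedSelmerStructure_inr (hw : ((p : ℕ) : 𝓞 ℚ) ∉ w.asIdeal) :
    Finite (propagatedSelmerStructure W p k (Sum.inr w)) := by
  have h : ∀ (n : ℤ) (N : ℕ), N ≠ 0 → n = N → Finite (W.kummerSelmerStructure n (Sum.inr w)) := by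
    intro n N hN hn; subst hn; exact W.finite_kummerSelmerStructure_inr w hN
  rw [propagatedSelmerStructure_inr_eq_kummerSelmerStructure W p k hw]
  exact h _ (p ^ (k + 1)) (pow_ne_zero _ hp.out.ne_zero) (by push_cast; ring)

omit [W.IsElliptic] hp in
/-- **`#Φ_w = c_w`**: the component quotient `X(ℚ_w)/X₀(ℚ_w)` of the minimal model has order the local
Tamagawa number (tree `localTamagawaNumber_eq_index_nonsingularReductionSubgroup`), and is finite.
[cite: SilvermanAEC2009, §VII.6 (Ex. 7.6: `c_v = [E(K_v):E₀(K_v)]`)] -/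
theorem natCard_componentQuotient_eq_localTamagawaNumber :
    Nat.card (((W.localMinimalIntegralModel w).baseChange (w.adicCompletion ℚ)).toAffine.Point ⧸
        (W.localMinimalIntegralModel w).nonsingularReductionSubgroup
          (integers_valuationRing_valuation (w.adicCompletionIntegers ℚ) (w.adicCompletion ℚ))) =
      (W.baseChange (w.adicCompletion ℚ)).localTamagawaNumber (w.adicCompletionIntegers ℚ) := by
  rw [localTamagawaNumber_eq_index_nonsingularReductionSubgroup, AddSubgroup.index_eq_card]

omit hp in
/-- The component quotient `Φ_w = X(ℚ_w)/X₀(ℚ_w)` is finite (`c_w ≠ 0`). [folklore] -/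
theorem finite_componentQuotient :
    Finite (((W.localMinimalIntegralModel w).baseChange (w.adicCompletion ℚ)).toAffine.Point ⧸
        (W.localMinimalIntegralModel w).nonsingularReductionSubgroup
          (integers_valuationRing_valuation (w.adicCompletionIntegers ℚ) (w.adicCompletion ℚ))) := by
  refine Nat.finite_of_card_ne_zero ?_
  rw [natCard_componentQuotient_eq_localTamagawaNumber]
  exact W.localTamagawaNumber_baseChange_ne_zero w

/-! ### §2 Strictness when `p ∣ c_w`; equality iff `p ∤ c_w` -/

/-- **`p ∣ c_w ⇒ #Φ_w[p^{k+1}] > 1`** (Cauchy: an element of order `p` in `Φ_w`). [folklore] -/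
theorem one_lt_natCard_torsionBy_componentQuotient_of_dvd
    (hc : p ∣ (W.baseChange (w.adicCompletion ℚ)).localTamagawaNumber (w.adicCompletionIntegers ℚ)) :
    1 < Nat.card (AddSubgroup.torsionBy
        (((W.localMinimalIntegralModel w).baseChange (w.adicCompletion ℚ)).toAffine.Point ⧸
          (W.localMinimalIntegralModel w).nonsingularReductionSubgroup
            (integers_valuationRing_valuation (w.adicCompletionIntegers ℚ) (w.adicCompletion ℚ)))
        (p ^ (k + 1) : ℕ)) := by
  haveI := finite_componentQuotient W w
  rw [← natCard_componentQuotient_eq_localTamagawaNumber] at hc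
  obtain ⟨x, hx⟩ := exists_prime_addOrderOf_dvd_card' p hc
  have hx0 : x ≠ 0 := by
    intro h; rw [h, addOrderOf_zero] at hx; exact hp.out.one_lt.ne' hx.symm
  have hxmem : x ∈ AddSubgroup.torsionBy
      (((W.localMinimalIntegralModel w).baseChange (w.adicCompletion ℚ)).toAffine.Point ⧸
        (W.localMinimalIntegralModel w).nonsingularReductionSubgroup
          (integers_valuationRing_valuation (w.adicCompletionIntegers ℚ) (w.adicCompletion ℚ)))
      (p ^ (k + 1) : ℕ) := by
    rw [AddSubgroup.torsionBy.nsmul_iff, pow_succ, mul_smul, ← hx, addOrderOf_nsmul_eq_zero, smul_zero]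
  haveI : Finite (AddSubgroup.torsionBy
      (((W.localMinimalIntegralModel w).baseChange (w.adicCompletion ℚ)).toAffine.Point ⧸
        (W.localMinimalIntegralModel w).nonsingularReductionSubgroup
          (integers_valuationRing_valuation (w.adicCompletionIntegers ℚ) (w.adicCompletion ℚ)))
      (p ^ (k + 1) : ℕ)) := inferInstance
  rw [Finite.one_lt_card_iff_nontrivial]
  exact ⟨⟨⟨x, hxmem⟩, 0, fun h ↦ hx0 (congrArg Subtype.val h)⟩⟩

/-- **[MR04] Prop. 6.2.6's local sentence, every reduction type, every level: `p ∣ c_w ⇒ 𝓕_u(w)_k ⊊ 𝓕_can(w)_k`.**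
At a finite place `w ∤ p` with `p` dividing the Tamagawa number `c_w = [E(ℚ_w) : E₀(ℚ_w)]`, Mazur–Rubin's
unramified condition `𝓕_u(w) = blochKatoSelmerStructure p (tateTorsionDatum W p k) L (Sum.inr w)` on
`E[p^k · p]` is STRICTLY smaller than the canonical condition `𝓕_can(w) = propagatedSelmerStructure W p k (Sum.inr w)`
(`#𝓕_can = #𝓕_u · #Φ_w[p^{k+1}]` with `#Φ_w[p^{k+1}] > 1`).  ([MR04] obtains this for `p > 3` from
«`p ∣ c_ℓ ⇒` split multiplicative»; here also the additive types, e.g. IV/IV* with `c_w = 3 = p`.)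
[cite: MazurRubin2004, Prop. 6.2.6 (p. 75) and App. A Remark A.5 (p. 81)] [cite: Rubin2000, Lemma 1.3.5] -/
theorem blochKatoSelmerStructure_lt_propagatedSelmerStructure_of_dvd_localTamagawaNumber
    (L : (tateTorsionDatum W p k).LocalConditionsAbove p) (hw : ((p : ℕ) : 𝓞 ℚ) ∉ w.asIdeal)
    (hc : p ∣ (W.baseChange (w.adicCompletion ℚ)).localTamagawaNumber (w.adicCompletionIntegers ℚ)) :
    blochKatoSelmerStructure p (tateTorsionDatum W p k) L (Sum.inr w) <
      propagatedSelmerStructure W p k (Sum.inr w) := by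
  refine lt_of_le_of_ne (blochKatoSelmerStructure_inr_le_propagatedSelmerStructure W p k w L hw) fun h ↦ ?_
  haveI := finite_propagatedSelmerStructure_inr W p k w hw
  haveI : Nonempty (propagatedSelmerStructure W p k (Sum.inr w)) := ⟨0⟩
  have hcard := natCard_propagatedSelmerStructure_inr_eq_mul W p k w hw L
  have hlt := one_lt_natCard_torsionBy_componentQuotient_of_dvd W p k w hc
  rw [h] at hcard
  have hpos : 0 < Nat.card (propagatedSelmerStructure W p k (Sum.inr w)) := Nat.card_pos
  have key : ∀ m : ℕ, Nat.card (propagatedSelmerStructure W p k (Sum.inr w)) =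
      Nat.card (propagatedSelmerStructure W p k (Sum.inr w)) * m → 1 < m → False := by
    intro m h1 h2; nlinarith
  exact key _ hcard hlt

/-- **The places of Tamagawa defect: `𝓕_u(w)_k = 𝓕_can(w)_k ↔ p ∤ c_w`** (any reduction type, any `p` with
`w ∤ p`, any `k`): the exponent-zero theorem of gen 3
(`blochKatoSelmerStructure_inr_eq_propagatedSelmerStructure_of_not_dvd_localTamagawaNumber`) and the
strictness above.  In Büyükboduk's words: hypothesis H.T (`p` divides no Tamagawa number) is exactly the
absence of defect. [cite: MazurRubin2004, Prop. 6.2.6 (p. 75) and App. A Remark A.5 (p. 81)] [cite: Rubin2000, Lemma 1.3.5] -/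
theorem blochKatoSelmerStructure_eq_propagatedSelmerStructure_iff_not_dvd
    (L : (tateTorsionDatum W p k).LocalConditionsAbove p) (hw : ((p : ℕ) : 𝓞 ℚ) ∉ w.asIdeal) :
    blochKatoSelmerStructure p (tateTorsionDatum W p k) L (Sum.inr w) =
        propagatedSelmerStructure W p k (Sum.inr w) ↔
      ¬ p ∣ (W.baseChange (w.adicCompletion ℚ)).localTamagawaNumber (w.adicCompletionIntegers ℚ) := by
  constructor
  · intro h hc
    exact (blochKatoSelmerStructure_lt_propagatedSelmerStructure_of_dvd_localTamagawaNumber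
      W p k w L hw hc).ne h
  · exact blochKatoSelmerStructure_inr_eq_propagatedSelmerStructure_of_not_dvd_localTamagawaNumber
      W p k w L hw

/-! ### §3 The index at deep levels: `[𝓕_can(w) : 𝓕_u(w)] = (c_w)_p` -/

/-- At a level `k` with `p^{v_p(c_w)} ∣ p^{k+1}`, the `p^{k+1}`-torsion of `Φ_w` is its whole `p`-primary part,
of order `p^{v_p(c_w)}`. [folklore] -/
theorem natCard_torsionBy_componentQuotient_eq_pow_padicValNat
    (hk : p ^ padicValNat p ((W.baseChange (w.adicCompletion ℚ)).localTamagawaNumber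
      (w.adicCompletionIntegers ℚ)) ∣ p ^ (k + 1)) :
    Nat.card (AddSubgroup.torsionBy
        (((W.localMinimalIntegralModel w).baseChange (w.adicCompletion ℚ)).toAffine.Point ⧸
          (W.localMinimalIntegralModel w).nonsingularReductionSubgroup
            (integers_valuationRing_valuation (w.adicCompletionIntegers ℚ) (w.adicCompletion ℚ)))
        (p ^ (k + 1) : ℕ)) =
      p ^ padicValNat p ((W.baseChange (w.adicCompletion ℚ)).localTamagawaNumber
        (w.adicCompletionIntegers ℚ)) := by
  haveI := finite_componentQuotient W w
  set Q := ((W.localMinimalIntegralModel w).baseChange (w.adicCompletion ℚ)).toAffine.Point ⧸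
    (W.localMinimalIntegralModel w).nonsingularReductionSubgroup
      (integers_valuationRing_valuation (w.adicCompletionIntegers ℚ) (w.adicCompletion ℚ)) with hQ
  have hprim : Nat.card (AddCommGroup.primaryComponent Q p) =
      p ^ padicValNat p ((W.baseChange (w.adicCompletion ℚ)).localTamagawaNumber
        (w.adicCompletionIntegers ℚ)) := by
    rw [Literature.NumberTheory.EllipticCurves.natCard_primaryComponent_eq_pow_padicValNat p,
      natCard_componentQuotient_eq_localTamagawaNumber]
  rw [← hprim]
  refine Nat.card_congr (Equiv.subtypeEquivRight fun x ↦ ?_)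
  change x ∈ AddSubgroup.torsionBy Q (p ^ (k + 1) : ℕ) ↔ x ∈ AddCommGroup.primaryComponent Q p
  rw [AddSubgroup.torsionBy.nsmul_iff, AddCommGroup.mem_primaryComponent]
  constructor
  · exact fun h ↦ ⟨k + 1, h⟩
  · rintro ⟨m, hm⟩
    -- the order of `x` divides `#Q[p^∞] = p^{v_p(c_w)} ∣ p^{k+1}`
    have hxmem : x ∈ AddCommGroup.primaryComponent Q p := (AddCommGroup.mem_primaryComponent).mpr ⟨m, hm⟩
    haveI : Finite (AddCommGroup.primaryComponent Q p) := inferInstance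
    have hord : addOrderOf (⟨x, hxmem⟩ : AddCommGroup.primaryComponent Q p) ∣ p ^ (k + 1) :=
      (addOrderOf_dvd_natCard _).trans (hprim ▸ hk)
    have h := addOrderOf_dvd_iff_nsmul_eq_zero.mp hord
    exact congrArg Subtype.val h

/-- **`[𝓕_can(w) : 𝓕_u(w)] = (c_w)_p` at deep levels** (Büyükboduk, JNT 129 (2009) §2.1.2 Remark 2; Rubin,
*Euler Systems*, Lemma 1.3.5): at a finite `w ∤ p` and a level `k` with `p^{v_p(c_w)} ∣ p^{k+1}`,
`#𝓕_can(w)_k = #𝓕_u(w)_k · p^{v_p(c_w)}`. [cite: Rubin2000, Lemma 1.3.5]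
[cite: MazurRubin2004, Prop. 6.2.6 (p. 75) and App. A Remark A.5 (p. 81)] -/
theorem natCard_propagatedSelmerStructure_inr_eq_mul_pow_padicValNat
    (L : (tateTorsionDatum W p k).LocalConditionsAbove p) (hw : ((p : ℕ) : 𝓞 ℚ) ∉ w.asIdeal)
    (hk : p ^ padicValNat p ((W.baseChange (w.adicCompletion ℚ)).localTamagawaNumber
      (w.adicCompletionIntegers ℚ)) ∣ p ^ (k + 1)) :
    Nat.card (propagatedSelmerStructure W p k (Sum.inr w)) =
      Nat.card (blochKatoSelmerStructure p (tateTorsionDatum W p k) L (Sum.inr w)) *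
        p ^ padicValNat p ((W.baseChange (w.adicCompletion ℚ)).localTamagawaNumber
          (w.adicCompletionIntegers ℚ)) := by
  rw [natCard_propagatedSelmerStructure_inr_eq_mul W p k w hw L]
  congr 1
  exact natCard_torsionBy_componentQuotient_eq_pow_padicValNat W p k w hk

end Summit.BirchSwinnertonDyer.BirchSwinnertonDyer.Theorems.KimAtThreeD7uTamagawaIndex

end
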